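import Summits.ResolutionOfSingularities.ResolutionOfSingularities.Theses.AbhyankarShadows
import Summits.ResolutionOfSingularities.ResolutionOfSingularities.Theorems.ValuativeLuAlphaPTorsorAPTorsion
import Literature.AlgebraicGeometry.Resolution.KnafKuhlmann2005Thm34Stability
import Literature.AlgebraicGeometry.Resolution.AbhyankarInvariants
import Literature.AlgebraicGeometry.Resolution.SeparablyDefectlessDenseDescent
import Literature.AlgebraicGeometry.Resolution.GeneralizedStability
import Mathlib.NumberTheory.FrobeniusNumber

/-!
# Disproof of `ShadowsUniformize` — findings: NOT refutable (crux = target + hypothesis); shadow hypothesis FREE on the finitely-generated-semigroup locus and (on paper) wherever embedded LU holds; [fg] ∧ [exact] the only load-bearing clauses; the c2 dense-Abhyankar carve-out is EMPTY in rational rank one (value group f.g. ⇒ cyclic); the core locus already contains infinitely singular valuations of `k(x,y)`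

Standing disprover's work file for crux `stmt-ResolutionOfSingularities-16756`
(`AbhyankarShadows.ShadowsUniformize`, route AbhyankarShadows, crux #2: the TRANSFER half of
Teissier's semivaluation conjecture, arXiv:2311.12456 p. 5, in the planner's typing). Cycle 1
(gen 1, 2026-08-17 09–10Z) and cycle 2 (gen 2, 2026-08-17 from 12:46Z). Everything below is
sorry-free. LANDED (all ACCEPTED, importable by provers and planners):
`Theorems/ShadowsUniformize/Negative/IdentityShadow.lean` (§0–§2, p153364),
`Theorems/ShadowsUniformize/Negative/LoadBearing.lean` (§3 without the two `_iff` one-liners, p164454),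
`Theorems/ShadowsUniformize/Negative/DenseAbhyankarValueGroup.lean` (§4, p164208).

## Index of findings

* (A) IRREFUTABILITY — `not_lurelRational_of_not_shadowsUniformize` (§0). The crux is the route's
  target `LurelRational` with ONE extra hypothesis; `LurelRational → ShadowsUniformize` by dropping it.
  Hence `¬ ShadowsUniformize` would be a counterexample to relative local uniformization at a rational
  place of a function field over an algebraically closed field of characteristic `p` — the open core
  of the summit. No instance search, degenerate case or barrier reduction can kill the crux; the
  route's kill criterion ("shadows exist but no finite `F` transfers") is about the toric MECHANISM,
  which the typed statement never mentions. WHY IT RESISTS: its conclusion is never knowingly false.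
* (B) THE HYPOTHESIS IS FREE ON A LARGE LOCUS — §2. `shadow_of_fg_semigroup`: if some model
  `R₁ ⊇ R` (`Frac R₁ = K`) has finitely generated value semigroup, the IDENTITY (`L = K`, `φ = R₁ ↪ K`,
  `O' = O`, `ι = id`) satisfies all eight shadow clauses for every `F` (by `rfl`).
  `semigroup_fg_of_isCyclic_valueGroup`: at a DISCRETE rank-one place (value group `ℤ`) EVERY model
  has finitely generated semigroup (numerical semigroups, `Nat.addSubmonoid_fg`), so
  `hasShadows_of_isCyclic_valueGroup` discharges the hypothesis with no input and
  `lurel_of_shadowsUniformize_of_isCyclic_valueGroup` shows: the crux CONTAINS local uniformization at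
  all discrete rational places, any dimension, with the toric engine idle (`gr_ν R₁ = k[t^S]`,
  `S ⊆ ℕ`). These places are non-Abhyankar for `trdeg K ≥ 2`. TRUE there (Knaf–Kuhlmann 2009
  Thm. 1.5) and — since lead c1 — PROVED IN THE TREE (`lurelRational_of_isCyclic_valueGroup`, p157678).
* (C) LOAD-BEARING CLAUSES — §3 (= `Negative/LoadBearing.lean`, p164454; the `_iff` forms stay here).
  Deleting [fg]: identity shadow serves every `(O, R)` ⇒ mutated crux `↔ LurelRational` (`shadowsUniformize_without_fg_iff`).
  Deleting [exact]: the RESIDUE-CONSTANT shadow `y ↦ c ∈ k` with `ν(y - c) > 0`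
  (`residueConstantShadow`: a `k`-algebra map, same centre, semigroup `{0,1}`, values in `ν(R₁)`)
  serves every `(O, R)` ⇒ mutated crux `↔ LurelRational` (`shadowsUniformize_without_exact_iff`).
  So [fg] ∧ [exact] jointly are the only channel through which a shadow sees `ν` off its centre;
  [rank] [centre] [inside] [rational'] [inj] [values] are normalisations.
* (D) DEGENERATE CASES (checked on paper, all harmless): `O = ⊤` forces `K = k` (rationality), then
  `A = ⊤` works; `R = ⊥`: conclusion = "some regular model along `ν`"; `F ⊆ units ∪ {0}`: evaluation
  shadow works but other `F` do not; `Module.finrank ℤ (Additive Γˣ)` IS the rational rank (torsion-free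
  groups; `0` only for infinite rank, excluded by Abhyankar's inequality); `MonoidHom.mrange … .FG`
  with the zero adjoined is equivalent to finite generation of `ν(R₁ ∖ 0)`.
* (E) JUNK SHADOWS FROM EMBEDDED LU, ANY RATIONAL RANK (paper; §5 docblock, sharpening refuter ATTACK.md
  §4 on the item). If EMBEDDED local uniformization holds for `(R, ν, F ∪ {z₁,…,z_r})` (`zⱼ ∈ R` with
  `ℚ`-independent values, `r = rr O`) — a regular model `A ⊇ R` in `O` on which each of these elements
  is a unit times a monomial in a regular system of parameters `u ⊆ A` — then the MONOMIAL WEDGE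
  `φ : A → k⟦s₁,…,s_r⟧`, `uᵢ ↦ s^{bᵢ}`, with `O'` the monomial valuation of weights `g₁,…,g_r` (a
  Perron basis of the lattice `⟨ν(u₁),…,ν(u_d)⟩ ≅ ℤ^r` making all `ν(uᵢ) = Σⱼ bᵢⱼ gⱼ`, `bᵢⱼ ∈ ℕ` —
  tree `Temkin2013_thmA_2_1`) and `ι(eⱼ) = gⱼ` satisfies ALL eight clauses: [fg] because the orders
  of `φ(A) ⊆ k⟦s^{b₁},…,s^{b_d}⟧` are exactly the images of the finitely generated monoid `Σ ℕ bᵢ`,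
  [values] because `ι(Σ cᵢbᵢ) = ν(u^c)`, [exact] because units have value `0`. (For `r = 1` this is
  the scaled arc `uᵢ ↦ t^{ν(uᵢ)/h}`, `h` = gcd of the parameter values; no Euclidean preparation is
  needed since `h` itself need not be a value.) So `HasShadows O R` holds wherever embedded LU of
  finitely many elements along `ν` is known: all of `trdeg K = 2` (Zariski 1939 / Abhyankar 1956),
  `trdeg 3` (Cossart–Piltant 2008/9 LU + Cutkosky, Amer. J. Math. 131 (2009) Thm. 1.2 embedded
  resolution of surfaces / Thm. 1.3 principalization of ideals in nonsingular threefolds, any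
  characteristic, pp. 2, read), every place after LU + log-principalisation. CALIBRATION answer to lead c1's `disprover-wanted`: YES,
  `HasShadows` holds at every rational surface valuation — by the above, or directly for
  `R ⊆ k[x,y]` by key-polynomial curvettes (MacLane: for `deg_y F < deg φₙ` the branch
  semivaluation of the `n`-th key polynomial is exact on `F`, has the plane-branch semigroup
  `⟨β̄₀,…,β̄ₙ₋₁⟩ ⊆ ν(R ∖ 0)`, same centre, residue field `k`). A CORE-locus `(O, R)` where
  `HasShadows` FAILS would therefore sit in `trdeg ≥ 4` beyond known embedded LU — it cannot be
  exhibited by this seat (it would be news about local uniformization itself). ANSWER to lead c2's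
  renewed `disprover-wanted` ("a core `(O,R)` in trdeg 3, rank 1, `Γ = ℤ[1/p]` or non-f.g., where
  `HasShadows` fails"): on paper NO SUCH PAIR EXISTS in `trdeg ≤ 3` (CP 2008/9 + Cutkosky 2009
  Thms 1.2/1.3 give embedded LU of every finite `F` along every valuation, hence monomial-wedge shadows);
  `¬ HasShadows O R` anywhere would REFUTE embedded local uniformization at `(R, ν)` — the typed
  hypothesis has teeth exactly where embedded LU is unknown, and nowhere that can be certified today. Upshot: the typed
  hypothesis is "embedded LU-lite" (existence of monomial wedges with exact `ν`-orders on finite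
  sets) and the crux reads "embedded-LU-lite ⇒ LU".
* (F) REPAIRS ON RECORD (planner's call, not this seat's): prior seats proposed adding
  `ringKrullDim φ.range = rr O` (Teissier's "quotients of dimension `r`") and pinning the shadow
  semigroup to an initial segment of the minimal generators of `ν(R₁ ∖ 0)` on a model fixed BEFORE
  `∀ F`; (B) shows the first repair alone still leaves the crux ⊇ LU wherever genuine low-dimensional
  shadows exist cheaply. For rank one the minimal generating system of `ν(R₁ ∖ 0)` is well defined
  (no accumulation of values below a bound, Cutkosky–Teissier 2008), so the second repair is well-posed.
* (G) NEW (cycle 2) — THE c2 DENSE-ABHYANKAR CARVE-OUT HAS A FINITELY GENERATED VALUE GROUP — §4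
  (= `Negative/DenseAbhyankarValueGroup.lean`, p164208). `group_fg_valueGroup_of_isAbhyankarPlace_of_isDenseIn`:
  if `O ∋ k` lies in the completion of an Abhyankar subfunction field `K₀` (the skeleton's
  `IsDenseAbhyankar O`, unfolded), its value group is a finitely generated group (Temkin 2013
  Rem. 2.1.3 on `K₀` via the tree's `valueGroup_fg_of_transcendenceDefect_eq_zero` +
  `transcendenceDefect_comap_eq_zero_of_isAbhyankarPlace`, and density `vK = vK₀` via the tree's
  `unitsValueGroupHom`). Hence `isCyclic_valueGroup_of_isAbhyankarPlace_of_isDenseIn`: with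
  `Module.finrank ℤ ≤ 1` the value group is CYCLIC, and
  `not_denseAbhyankar_of_not_isCyclic_of_finrank_le_one`: the core stub's new hypothesis `hnD` is
  IMPLIED by `hndisc` in rational rank `≤ 1` — the carve-out removes nothing there; likewise
  `not_denseAbhyankar_of_not_group_fg` for every non-finitely-generated value group in any rank.
* (H) NEW — THE CORE LOCUS IS NON-EMPTY ALREADY FOR `k(x, y)` (print + paper, §5): Kuhlmann, Trans. AMS
  356 (2004) = arXiv:1003.5685, Thm. 1.1 (p. 3, read: "every additive subgroup of `ℚ` and every
  countably generated algebraic extension of `K` can be realized as value group and residue field of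
  a place of the rational function field `K(x,y)|K` whose restriction to `K` is the identity";
  MacLane–Schilling 1939, Zariski–Samuel VI §15 Ex. 3–4): with `K = k` algebraically closed, residue
  field `k` and `Γ ≤ ℚ` NOT cyclic this is a rational rank-one place of `k(x,y)` whose value group is
  not finitely generated — so not cyclic, not Abhyankar, by (G) not dense-Abhyankar, and (rank one)
  not composite: a CORE place of a SURFACE (explicitly: `x ↦ t`, `y ↦ Σᵢ t^{eᵢ}` in `k((t^ℚ))` with
  exponents of unbounded prime-to-`p` denominators). There relative LU is Zariski's 1939 theorem,
  classical but not in the tree (CJS 2020 / Cossart–Piltant are NAMED FACTS there). So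
  `stub_shadowFrameTransfer_core` is blocked not only on the open problem (`trdeg ≥ 4`) but also on
  un-formalised classical surface/threefold uniformization; a `trdeg K ≤ 3` carve-out is available
  only modulo those named facts (lead c2's CYCLE-c2 report concurs: "surface LU … NOT in tree").
* (I) LINE `birth` after the c2 reshape (§5): `ShadowsUniformize_of` is kernel-checked from the seven
  registered stubs — no smuggled gap (joint sufficiency holds by construction: four branches by
  `by_cases`). Stub verdicts: `stub_isAbhyankarPlace_map`, `stub_separablyGenerated_of_linDisjoint`,
  `stub_separatingTower`, `stub_denseTower_ambient` LANDED; `stub_linDisjoint_of_dense_defectless`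
  (KK09 Lemma 3.12 heart) judged TRUE as typed (purely inseparable `F₀(d)` has a unique prolongation,
  defectlessness gives a standard valuation basis `aᵢbⱼ` of `F₀(d)/F₀`, which stays `K'`-independent
  because `vK' = vF₀`, `K'v = F₀v` by density; linear disjointness is symmetric) — degenerate cases
  (`F₀` trivially valued forces `K' = F₀`; `n = 0`) harmless; `stub_denseAbhyankarAssembly` TRUE
  (plumbing); `stub_shadowFrameTransfer_core` = LU on the core (its extra conclusion
  `ToricShadowFrame` follows from regularity on paper: quotient by `d - r` parameters + a monomial
  valuation of rational rank `r` on the regular quotient), irrefutable, see (A), (E), (H). Reshape #3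
  (lead c2 cycle 3, skeleton f480c436…, after this file's §4 was written): dense-Abhyankar branch fully
  LANDED (p162032 Lemma 3.12, p162456 KK09 Thm 1.5), new COMPOSITE-DISCRETE branch (p163332, p163499,
  p163456, p163740) and a fourth core hypothesis `hnC : ¬ IsCompositeDiscrete O`; for RANK-ONE `O` (the
  whole `trdeg 2` core and the `Γ ≤ ℚ` part in general) `hnC`, like `hnD` (§4), is decoration: the only
  coarsenings of a rank-one `O` are `O` and `⊤`, excluded by `hnA`/`hnD` resp. `hndisc`.

-- Targets: none handed over (payload `targets = []`, `stuck_stubs = []`); the lead's only STUCK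
-- stub is `stub_shadowFrameTransfer_core`, attacked in (E), (G), (H): not killable, and its `hnD`
-- hypothesis is decoration in rational rank one.
-/

noncomputable section

open Summit.ResolutionOfSingularities.ResolutionOfSingularities.Theses.AbhyankarShadows

-- single-problem summit: the doubled namespace component is forced
set_option linter.dupNamespace false

namespace Summit.ResolutionOfSingularities.ResolutionOfSingularities.Cruxes.ShadowsUniformize.Disproof

/-! ## §0 Irrefutability: the crux is the target plus one hypothesis -/

/-- **`¬ ShadowsUniformize → ¬ LurelRational`**: the crux is the route's target weakened by the
shadow hypothesis (drop it: `LurelRational → ShadowsUniformize`, stated here contrapositively), so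
a refutation of the crux is a refutation of relative local uniformization at a rational place over
an algebraically closed field — the crux is not independently falsifiable. [folklore] -/
theorem not_lurelRational_of_not_shadowsUniformize : ¬ ShadowsUniformize → ¬ LurelRational :=
  fun hn h => hn fun p hp k K _ _ _ _ _ hfg O hO hrat R hR hRO _ => h p hp k K hfg O hO hrat R hR hRO

/-! ## §1 Helpers -/

section Helpers

variable {k K : Type} [Field k] [Field K] [Algebra k K]

/-- **Birational enlargement inside `O`**: if `K/k` is finitely generated and `O ∋ k` is a valuation
ring of `K`, every finitely generated `R ⊆ O` is contained in a finitely generated `R₁ ⊆ O` with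
`Frac R₁ = K` (adjoin each field generator `z` if `z ∈ O`, else `z⁻¹ ∈ O`). This is the "local
blowing up `R ≤ R₁`" slot of the shadow clause, filled for free. [folklore] -/
theorem exists_fg_isFractionRing_le (hKfg : (⊤ : IntermediateField k K).FG) (O : ValuationSubring K)
    (hk : ∀ c : k, algebraMap k K c ∈ O)
    (R : Subalgebra k K) (hR : R.FG) (hRO : R.toSubring ≤ O.toSubring) :
    ∃ R₁ : Subalgebra k K, R ≤ R₁ ∧ R₁.toSubring ≤ O.toSubring ∧ R₁.FG ∧ IsFractionRing R₁ K := by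
  classical
  obtain ⟨s, hs⟩ := hKfg
  obtain ⟨t, ht⟩ := hR
  let s' : Finset K := s.image fun z => if z ∈ O then z else z⁻¹
  have hs'O : ∀ z ∈ s', z ∈ O := by
    intro z hz
    obtain ⟨w, -, rfl⟩ := Finset.mem_image.mp hz
    by_cases hw : w ∈ O
    · simp [hw]
    · simpa [hw] using (O.mem_or_inv_mem w).resolve_left hw
  let Ok : Subalgebra k K :=
    { O.toSubring.toSubsemiring with
      algebraMap_mem' := fun c => hk c }
  have hOk : ∀ z : K, z ∈ Ok ↔ z ∈ O := fun z => Iff.rfl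
  refine ⟨Algebra.adjoin k ((t : Set K) ∪ (s' : Set K)), ?_, ?_, ⟨t ∪ s', by simp⟩, ?_⟩
  · rw [← ht]
    exact Algebra.adjoin_mono Set.subset_union_left
  · have : Algebra.adjoin k ((t : Set K) ∪ (s' : Set K)) ≤ Ok := by
      refine Algebra.adjoin_le ?_
      rintro z (hz | hz)
      · exact (hOk z).mpr (hRO (ht ▸ Algebra.subset_adjoin hz))
      · exact (hOk z).mpr (hs'O z hz)
    intro z hz
    exact this hz
  · set R₁ := Algebra.adjoin k ((t : Set K) ∪ (s' : Set K)) with hR₁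
    have hsub : Subfield.closure (Set.range (algebraMap k K) ∪ (s : Set K)) ≤
        Subfield.closure (R₁ : Set K) := by
      refine Subfield.closure_le.mpr ?_
      rintro z (⟨c, rfl⟩ | hz)
      · exact Subfield.subset_closure (R₁.algebraMap_mem c)
      · by_cases hzO : z ∈ O
        · refine Subfield.subset_closure (Algebra.subset_adjoin (Or.inr ?_))
          exact Finset.mem_coe.mpr (Finset.mem_image.mpr ⟨z, hz, by simp [hzO]⟩)
        · have hz' : z⁻¹ ∈ (R₁ : Set K) := Algebra.subset_adjoin (Or.inr
            (Finset.mem_coe.mpr (Finset.mem_image.mpr ⟨z, hz, by simp [hzO]⟩)))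
          rw [← inv_inv z]
          exact inv_mem (Subfield.subset_closure hz')
    refine IsFractionRing.of_field R₁ K fun z => ?_
    have hz : z ∈ Subfield.closure (R₁ : Set K) := by
      apply hsub
      have : z ∈ IntermediateField.adjoin k (s : Set K) := by rw [hs]; trivial
      exact this
    rw [Subfield.mem_closure_iff] at hz
    obtain ⟨a, ha, b, hb, rfl⟩ := hz
    have hcl' : Subring.closure (R₁ : Set K) = R₁.toSubring := by
      rw [← Subalgebra.coe_toSubring, Subring.closure_eq]
    rw [hcl'] at ha hb
    exact ⟨⟨a, ha⟩, ⟨b, hb⟩, rfl⟩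

/-- **Uniqueness of the residue constant**: two constants congruent to the same `x` modulo the
maximal ideal of `O ⊇ k` coincide. [folklore] -/
theorem residueConstant_unique (O : ValuationSubring K) (hk : ∀ c : k, algebraMap k K c ∈ O)
    {x : K} {c c' : k} (h : O.valuation (x - algebraMap k K c) < 1)
    (h' : O.valuation (x - algebraMap k K c') < 1) : c = c' := by
  by_contra hne
  have hlt : O.valuation (algebraMap k K (c' - c)) < 1 := by
    have : algebraMap k K (c' - c) = (x - algebraMap k K c) - (x - algebraMap k K c') := by
      rw [map_sub]; ring
    rw [this]
    exact Valuation.map_sub_lt _ h h'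
  have h1 := Summit.ResolutionOfSingularities.ResolutionOfSingularities.Theorems.PfaffLine.ap_valuation_algebraMap_eq_one O hk (sub_ne_zero.mpr (Ne.symm hne))
  rw [h1] at hlt
  exact lt_irrefl _ hlt

end Helpers

/-! ## §2 The identity-shadow locus: finitely generated value semigroup, e.g. value group `ℤ` -/

section IdentityShadow

variable {k K : Type} [Field k] [Field K] [Algebra k K]

/-- **The identity shadow.** If `R ≤ R₁ ⊆ O`, `R₁` finitely generated with `Frac R₁ = K`, has
FINITELY GENERATED value semigroup `ν(R₁ ∖ 0) ∪ {0}`, then for every finite `F ⊆ R` the data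
`L := K`, `φ := (R₁ ↪ K)`, `O' := O`, `ι := id` satisfy ALL eight shadow clauses of the crux (each
by `rfl`): the shadow hypothesis asks nothing of `ν` beyond `R₁`'s semigroup. No algebraic
closedness, characteristic or finite generation of `K/k` is used. [folklore] -/
theorem shadow_of_fg_semigroup (O : ValuationSubring K)
    (hrat : ∀ x : K, x ∈ O → ∃ c : k, O.valuation (x - algebraMap k K c) < 1)
    (R : Subalgebra k K) (F : Finset R) (R₁ : Subalgebra k K) (hle : R ≤ R₁)
    (hR₁O : R₁.toSubring ≤ O.toSubring) (hR₁ : R₁.FG) (hfrac : IsFractionRing R₁ K)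
    (hfg : (MonoidHom.mrange (O.valuation.toMonoidWithZeroHom.toMonoidHom.comp
      R₁.val.toRingHom.toMonoidHom)).FG) :
    ∃ (R₁ : Subalgebra k K) (hle : R ≤ R₁) (_ : R₁.toSubring ≤ O.toSubring),
    R₁.FG ∧ IsFractionRing R₁ K ∧ ∃ (L : Type) (_ : Field L) (_ : Algebra k L) (φ : R₁ →ₐ[k] L)
    (O' : ValuationSubring L), Module.finrank ℤ (Additive (O'.ValueGroup)ˣ) =
      Module.finrank ℤ (Additive (O.ValueGroup)ˣ) ∧ (∀ y : R₁, φ y ∈ O') ∧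
    (∀ y : R₁, O'.valuation (φ y) < 1 ↔ O.valuation (y : K) < 1) ∧
    (∀ z : L, z ∈ O' → ∃ c : k, O'.valuation (z - algebraMap k L c) < 1) ∧
    (MonoidHom.mrange (O'.valuation.toMonoidWithZeroHom.toMonoidHom.comp
      φ.toRingHom.toMonoidHom)).FG ∧
    ∃ ι : O'.ValueGroup →*₀o O.ValueGroup, Function.Injective ι ∧
      (∀ y : R₁, φ y ≠ 0 → ∃ y' : R₁, ι (O'.valuation (φ y)) = O.valuation (y' : K)) ∧
      ∀ x ∈ F, ι (O'.valuation (φ (Subalgebra.inclusion hle x))) = O.valuation ((x : R) : K) :=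
  ⟨R₁, hle, hR₁O, hR₁, hfrac, K, inferInstance, inferInstance, R₁.val, O, rfl,
    fun y => hR₁O y.2, fun _ => Iff.rfl, hrat, hfg, OrderMonoidWithZeroHom.id _,
    fun _ _ h => h, fun y _ => ⟨y, rfl⟩, fun _ _ => rfl⟩

/-- **Numerical semigroups inside a discrete value group are finitely generated**: in a linearly
ordered commutative group with zero whose group of units is cyclic, every submonoid consisting of
elements `≤ 1` is finitely generated (pull back along `n ↦ gⁿ` for the generator `g ≤ 1` and use
that every submonoid of `ℕ` is finitely generated, Mathlib `Nat.addSubmonoid_fg`). [folklore] -/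
theorem submonoid_fg_of_isCyclic_units {Γ₀ : Type*} [LinearOrderedCommGroupWithZero Γ₀]
    [IsCyclic Γ₀ˣ] (M : Submonoid Γ₀) (hM : ∀ x ∈ M, x ≤ 1) : M.FG := by
  classical
  -- a generator `g ≤ 1` of the units, and `u ≤ 1 ⇒ u = g ^ n` for some `n : ℕ`
  obtain ⟨g, hg⟩ : ∃ g : Γ₀ˣ, (g : Γ₀) ≤ 1 ∧
      ∀ u : Γ₀ˣ, (u : Γ₀) ≤ 1 → ∃ n : ℕ, (g : Γ₀) ^ n = u := by
    obtain ⟨g₀, hg₀⟩ := IsCyclic.exists_generator (α := Γ₀ˣ)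
    rcases le_total (g₀ : Γ₀) 1 with hle | hle
    · refine ⟨g₀, hle, fun u hu => ?_⟩
      obtain ⟨m, rfl⟩ := Subgroup.mem_zpowers_iff.mp (hg₀ u)
      rcases Int.eq_nat_or_neg m with ⟨n, rfl | rfl⟩
      · exact ⟨n, by simp⟩
      · refine ⟨0, ?_⟩
        have h1 : ((g₀ ^ (n : ℤ))⁻¹ : Γ₀ˣ) = g₀ ^ (-(n : ℤ)) := by rw [zpow_neg]
        have hpow : ((g₀ : Γ₀) ^ n) ≤ 1 := pow_le_one' hle n
        have hu' : ((g₀ ^ (-(n : ℤ)) : Γ₀ˣ) : Γ₀) = ((g₀ : Γ₀) ^ n)⁻¹ := by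
          rw [← h1]; simp
        rw [hu'] at hu ⊢
        have h0 : (0 : Γ₀) < (g₀ : Γ₀) ^ n := zero_lt_iff.mpr (pow_ne_zero n g₀.ne_zero)
        have : (g₀ : Γ₀) ^ n = 1 := le_antisymm hpow ((inv_le_one₀ h0).mp hu)
        simp [this]
    · refine ⟨g₀⁻¹, by simpa using inv_le_one_of_one_le₀ hle, fun u hu => ?_⟩
      obtain ⟨m, rfl⟩ := Subgroup.mem_zpowers_iff.mp (hg₀ u)
      rcases Int.eq_nat_or_neg m with ⟨n, rfl | rfl⟩
      · refine ⟨0, ?_⟩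
        have hpow : 1 ≤ ((g₀ : Γ₀) ^ n) := one_le_pow_of_one_le' hle n
        have hu' : ((g₀ ^ (n : ℤ) : Γ₀ˣ) : Γ₀) = (g₀ : Γ₀) ^ n := by simp
        rw [hu'] at hu ⊢
        have : (g₀ : Γ₀) ^ n = 1 := le_antisymm hu hpow
        simp [this]
      · refine ⟨n, ?_⟩
        simp [zpow_neg, inv_pow]
  -- pull back along `n ↦ g ^ n`
  let f : Multiplicative ℕ →* Γ₀ := powersHom Γ₀ (g : Γ₀)
  let N : Submonoid (Multiplicative ℕ) := M.comap f
  have hN : N.FG := by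
    have := Nat.addSubmonoid_fg (AddSubmonoid.toSubmonoid.symm N)
    rw [AddSubmonoid.fg_iff_mul_fg] at this
    simpa using this
  obtain ⟨T, hT⟩ := hN
  refine (Submonoid.fg_iff M).mpr ⟨f '' (T : Set (Multiplicative ℕ)) ∪ ({0} ∩ (M : Set Γ₀)),
    ?_, (T.finite_toSet.image f).union ((Set.finite_singleton 0).inter_of_left _)⟩
  apply le_antisymm
  · refine Submonoid.closure_le.mpr ?_
    rintro x (⟨n, hn, rfl⟩ | ⟨-, hx⟩)
    · have : n ∈ N := hT ▸ Submonoid.subset_closure hn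
      exact this
    · exact hx
  · intro x hx
    by_cases hx0 : x = 0
    · exact Submonoid.subset_closure (Or.inr ⟨hx0, hx⟩)
    · obtain ⟨n, hn⟩ := hg.2 (Units.mk0 x hx0) (by simpa using hM x hx)
      have hfn : f (Multiplicative.ofAdd n) = x := by simpa [f] using hn
      have hnN : Multiplicative.ofAdd n ∈ N := by
        change f (Multiplicative.ofAdd n) ∈ M
        rwa [hfn]
      rw [← hT] at hnN
      have : f (Multiplicative.ofAdd n) ∈ Submonoid.map f (Submonoid.closure (T : Set _)) :=
        Submonoid.mem_map_of_mem f hnN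
      rw [MonoidHom.map_mclosure] at this
      rw [← hfn]
      exact Submonoid.closure_mono Set.subset_union_left this

/-- **At a discrete rank-one place every model has a finitely generated value semigroup**: if the
value group of `O` is cyclic, the semigroup `ν(R₁ ∖ 0) ∪ {0}` of every subalgebra `R₁ ⊆ O` is
finitely generated (a numerical semigroup with zero) — whether or not `O` is Abhyankar.
[folklore] -/
theorem semigroup_fg_of_isCyclic_valueGroup (O : ValuationSubring K)
    (hcyc : IsCyclic (O.ValueGroup)ˣ) (R₁ : Subalgebra k K) (hR₁O : R₁.toSubring ≤ O.toSubring) :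
    (MonoidHom.mrange (O.valuation.toMonoidWithZeroHom.toMonoidHom.comp
      R₁.val.toRingHom.toMonoidHom)).FG := by
  haveI := hcyc
  refine submonoid_fg_of_isCyclic_units _ ?_
  rintro x ⟨y, rfl⟩
  exact (O.valuation_le_one_iff _).mpr (hR₁O y.2)

/-- **The shadow hypothesis is free at discrete rational places.** For `K/k` finitely generated,
`O ∋ k` a rational valuation ring of `K` with CYCLIC value group and `R ⊆ O` finitely generated,
every finite `F ⊆ R` admits a shadow exact on `F` — verbatim the hypothesis of the crux — namely
the identity shadow on a birational enlargement `R₁ ⊇ R`. No algebraic closedness or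
characteristic hypothesis is used. [folklore] -/
theorem hasShadows_of_isCyclic_valueGroup (hKfg : (⊤ : IntermediateField k K).FG)
    (O : ValuationSubring K) (hk : ∀ c : k, algebraMap k K c ∈ O)
    (hrat : ∀ x : K, x ∈ O → ∃ c : k, O.valuation (x - algebraMap k K c) < 1)
    (hcyc : IsCyclic (O.ValueGroup)ˣ)
    (R : Subalgebra k K) (hR : R.FG) (hRO : R.toSubring ≤ O.toSubring) :
    ∀ F : Finset R, ∃ (R₁ : Subalgebra k K) (hle : R ≤ R₁) (_ : R₁.toSubring ≤ O.toSubring),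
    R₁.FG ∧ IsFractionRing R₁ K ∧ ∃ (L : Type) (_ : Field L) (_ : Algebra k L) (φ : R₁ →ₐ[k] L)
    (O' : ValuationSubring L), Module.finrank ℤ (Additive (O'.ValueGroup)ˣ) =
      Module.finrank ℤ (Additive (O.ValueGroup)ˣ) ∧ (∀ y : R₁, φ y ∈ O') ∧
    (∀ y : R₁, O'.valuation (φ y) < 1 ↔ O.valuation (y : K) < 1) ∧
    (∀ z : L, z ∈ O' → ∃ c : k, O'.valuation (z - algebraMap k L c) < 1) ∧
    (MonoidHom.mrange (O'.valuation.toMonoidWithZeroHom.toMonoidHom.comp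
      φ.toRingHom.toMonoidHom)).FG ∧
    ∃ ι : O'.ValueGroup →*₀o O.ValueGroup, Function.Injective ι ∧
      (∀ y : R₁, φ y ≠ 0 → ∃ y' : R₁, ι (O'.valuation (φ y)) = O.valuation (y' : K)) ∧
      ∀ x ∈ F, ι (O'.valuation (φ (Subalgebra.inclusion hle x))) = O.valuation ((x : R) : K) := by
  intro F
  obtain ⟨R₁, hle, hR₁O, hR₁, hfrac⟩ := exists_fg_isFractionRing_le hKfg O hk R hR hRO
  exact shadow_of_fg_semigroup O hrat R F R₁ hle hR₁O hR₁ hfrac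
    (semigroup_fg_of_isCyclic_valueGroup O hcyc R₁ hR₁O)

/-- **The crux contains local uniformization at all discrete rational places.** `ShadowsUniformize`
implies, with its shadow hypothesis discharged for free by the identity shadow, relative local
uniformization at every rational valuation ring with value group `ℤ` of every finitely generated
`K/k`, `k` algebraically closed of characteristic `p`, in every dimension. Such places are
non-Abhyankar for `trdeg K ≥ 2`; the statement is true (Knaf–Kuhlmann 2009, Thm. 1.5: `K` lies in
the completion `k((t))` of the Abhyankar subfield `k(t)`) but is a deep theorem absent from the
tree — a lower bound for the difficulty of ANY proof of the crux, on a locus where the toric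
transfer mechanism receives no information. [folklore] -/
theorem lurel_of_shadowsUniformize_of_isCyclic_valueGroup (h : ShadowsUniformize)
    (p : ℕ) (hp : p.Prime) (k K : Type) [Field k] [CharP k p] [IsAlgClosed k] [Field K]
    [Algebra k K] (hKfg : (⊤ : IntermediateField k K).FG)
    (O : ValuationSubring K) (hk : ∀ c : k, algebraMap k K c ∈ O)
    (hrat : ∀ x : K, x ∈ O → ∃ c : k, O.valuation (x - algebraMap k K c) < 1)
    (hcyc : IsCyclic (O.ValueGroup)ˣ)
    (R : Subalgebra k K) (hR : R.FG) (hRO : R.toSubring ≤ O.toSubring) :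
    ∃ (A : Subalgebra k K) (hA : A.toSubring ≤ O.toSubring), R ≤ A ∧ A.FG ∧ IsFractionRing A K ∧
      IsRegularLocalRing
        (Localization.AtPrime (Ideal.comap (Subring.inclusion hA) (IsLocalRing.maximalIdeal O))) :=
  h p hp k K hKfg O hk hrat R hR hRO (hasShadows_of_isCyclic_valueGroup hKfg O hk hrat hcyc R hR hRO)

/-- **General form of the loophole**: `ShadowsUniformize` implies relative local uniformization at
`(O, R)` for every finitely generated `R ⊆ O` with `Frac R = K` whose value semigroup is finitely
generated — the identity shadow at `R₁ = R` serves every `F`. This class contains every Abhyankar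
place after a modification (the KNOWN case, Knaf–Kuhlmann 2005 Thm. 1.1, in tree) but also
non-Abhyankar ones (value group `ℤ`; or `ν(x) = 1`, `ν(y) = √2`, `z ↦` a convergent generalized
power series in `x, y` on `k[x, y, z]`, rational rank `2 < 3`). [folklore] -/
theorem lurel_of_shadowsUniformize_of_fg_semigroup (h : ShadowsUniformize)
    (p : ℕ) (hp : p.Prime) (k K : Type) [Field k] [CharP k p] [IsAlgClosed k] [Field K]
    [Algebra k K] (hKfg : (⊤ : IntermediateField k K).FG)
    (O : ValuationSubring K) (hk : ∀ c : k, algebraMap k K c ∈ O)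
    (hrat : ∀ x : K, x ∈ O → ∃ c : k, O.valuation (x - algebraMap k K c) < 1)
    (R : Subalgebra k K) (hR : R.FG) (hRO : R.toSubring ≤ O.toSubring) (hfrac : IsFractionRing R K)
    (hfg : (MonoidHom.mrange (O.valuation.toMonoidWithZeroHom.toMonoidHom.comp
      R.val.toRingHom.toMonoidHom)).FG) :
    ∃ (A : Subalgebra k K) (hA : A.toSubring ≤ O.toSubring), R ≤ A ∧ A.FG ∧ IsFractionRing A K ∧
      IsRegularLocalRing
        (Localization.AtPrime (Ideal.comap (Subring.inclusion hA) (IsLocalRing.maximalIdeal O))) :=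
  h p hp k K hKfg O hk hrat R hR hRO fun F =>
    shadow_of_fg_semigroup O hrat R F R le_rfl hRO hR hfrac hfg

end IdentityShadow

/-! ## §3 Load-bearing clauses: deleting [fg] or [exact] collapses the crux onto the target -/

section LoadBearing

variable {k K : Type} [Field k] [Field K] [Algebra k K]

/-- **With [fg] deleted the shadow clause is free**: for EVERY valuation ring `O ∋ k` of a finitely
generated `K/k` which is rational, and every finitely generated `R ⊆ O`, the shadow clause minus
"the value semigroup of `ν'` on `φ(R₁)` is finitely generated" holds for every finite `F` (identity
shadow on a birational enlargement). [folklore] -/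
theorem shadowClause_without_fg (hKfg : (⊤ : IntermediateField k K).FG)
    (O : ValuationSubring K) (hk : ∀ c : k, algebraMap k K c ∈ O)
    (hrat : ∀ x : K, x ∈ O → ∃ c : k, O.valuation (x - algebraMap k K c) < 1)
    (R : Subalgebra k K) (hR : R.FG) (hRO : R.toSubring ≤ O.toSubring) :
    ∀ F : Finset R, ∃ (R₁ : Subalgebra k K) (hle : R ≤ R₁) (_ : R₁.toSubring ≤ O.toSubring),
    R₁.FG ∧ IsFractionRing R₁ K ∧ ∃ (L : Type) (_ : Field L) (_ : Algebra k L) (φ : R₁ →ₐ[k] L)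
    (O' : ValuationSubring L), Module.finrank ℤ (Additive (O'.ValueGroup)ˣ) =
      Module.finrank ℤ (Additive (O.ValueGroup)ˣ) ∧ (∀ y : R₁, φ y ∈ O') ∧
    (∀ y : R₁, O'.valuation (φ y) < 1 ↔ O.valuation (y : K) < 1) ∧
    (∀ z : L, z ∈ O' → ∃ c : k, O'.valuation (z - algebraMap k L c) < 1) ∧
    ∃ ι : O'.ValueGroup →*₀o O.ValueGroup, Function.Injective ι ∧
      (∀ y : R₁, φ y ≠ 0 → ∃ y' : R₁, ι (O'.valuation (φ y)) = O.valuation (y' : K)) ∧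
      ∀ x ∈ F, ι (O'.valuation (φ (Subalgebra.inclusion hle x))) = O.valuation ((x : R) : K) := by
  intro F
  obtain ⟨R₁, hle, hR₁O, hR₁, hfrac⟩ := exists_fg_isFractionRing_le hKfg O hk R hR hRO
  exact ⟨R₁, hle, hR₁O, hR₁, hfrac, K, inferInstance, inferInstance, R₁.val, O, rfl,
    fun y => hR₁O y.2, fun _ => Iff.rfl, hrat, OrderMonoidWithZeroHom.id _,
    fun _ _ h => h, fun y _ => ⟨y, rfl⟩, fun _ _ => rfl⟩

/-- **[fg] is load-bearing: without it the crux IS the target.** The crux with the clause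
"value semigroup of `ν'` on `φ(R₁)` finitely generated" deleted from its shadow hypothesis is
equivalent to `LurelRational` (its hypothesis being free, `shadowClause_without_fg`). [folklore] -/
theorem shadowsUniformize_without_fg_iff :
    (∀ p : ℕ, p.Prime → ∀ (k K : Type) [Field k] [CharP k p] [IsAlgClosed k] [Field K]
      [Algebra k K], (⊤ : IntermediateField k K).FG → ∀ O : ValuationSubring K,
      (∀ c : k, algebraMap k K c ∈ O) →
      (∀ x : K, x ∈ O → ∃ c : k, O.valuation (x - algebraMap k K c) < 1) →
      ∀ R : Subalgebra k K, R.FG → R.toSubring ≤ O.toSubring →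
      (∀ F : Finset R, ∃ (R₁ : Subalgebra k K) (hle : R ≤ R₁) (_ : R₁.toSubring ≤ O.toSubring),
        R₁.FG ∧ IsFractionRing R₁ K ∧ ∃ (L : Type) (_ : Field L) (_ : Algebra k L)
        (φ : R₁ →ₐ[k] L) (O' : ValuationSubring L),
        Module.finrank ℤ (Additive (O'.ValueGroup)ˣ) = Module.finrank ℤ (Additive (O.ValueGroup)ˣ) ∧
        (∀ y : R₁, φ y ∈ O') ∧ (∀ y : R₁, O'.valuation (φ y) < 1 ↔ O.valuation (y : K) < 1) ∧
        (∀ z : L, z ∈ O' → ∃ c : k, O'.valuation (z - algebraMap k L c) < 1) ∧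
        ∃ ι : O'.ValueGroup →*₀o O.ValueGroup, Function.Injective ι ∧
          (∀ y : R₁, φ y ≠ 0 → ∃ y' : R₁, ι (O'.valuation (φ y)) = O.valuation (y' : K)) ∧
          ∀ x ∈ F, ι (O'.valuation (φ (Subalgebra.inclusion hle x))) =
            O.valuation ((x : R) : K)) →
      ∃ (A : Subalgebra k K) (h : A.toSubring ≤ O.toSubring), R ≤ A ∧ A.FG ∧
        IsFractionRing A K ∧ IsRegularLocalRing
          (Localization.AtPrime (Ideal.comap (Subring.inclusion h) (IsLocalRing.maximalIdeal O)))) ↔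
    LurelRational :=
  ⟨fun h p hp k K _ _ _ _ _ hKfg O hk hrat R hR hRO =>
      h p hp k K hKfg O hk hrat R hR hRO (shadowClause_without_fg hKfg O hk hrat R hR hRO),
    fun h p hp k K _ _ _ _ _ hKfg O hk hrat R hR hRO _ => h p hp k K hKfg O hk hrat R hR hRO⟩

/-- **The residue-constant shadow.** For a rational valuation ring `O ∋ k` and any `R₁ ⊆ O`, the
map `φ : R₁ → K` sending `y` to the unique constant `c ∈ k` with `ν(y - c) > 0` is a `k`-algebra
homomorphism into `O` with the SAME CENTRE as `ν`, value semigroup `{0, 1}` (finitely generated),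
and every non-zero value of `φ` is a value of `ν` on `R₁` (namely `1 = ν(1)`). It satisfies every
shadow clause except exactness on `F`. [folklore] -/
theorem residueConstantShadow (O : ValuationSubring K) (hk : ∀ c : k, algebraMap k K c ∈ O)
    (hrat : ∀ x : K, x ∈ O → ∃ c : k, O.valuation (x - algebraMap k K c) < 1)
    (R₁ : Subalgebra k K) (hR₁O : R₁.toSubring ≤ O.toSubring) :
    ∃ φ : R₁ →ₐ[k] K, (∀ y : R₁, ∃ c : k, φ y = algebraMap k K c) ∧
      (∀ y : R₁, O.valuation ((y : K) - φ y) < 1) ∧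
      (∀ y : R₁, φ y ∈ O) ∧
      (∀ y : R₁, O.valuation (φ y) < 1 ↔ O.valuation (y : K) < 1) ∧
      (MonoidHom.mrange (O.valuation.toMonoidWithZeroHom.toMonoidHom.comp
        φ.toRingHom.toMonoidHom)).FG ∧
      (∀ y : R₁, φ y ≠ 0 → ∃ y' : R₁, O.valuation (φ y) = O.valuation (y' : K)) := by
  classical
  -- the residue constant and its uniqueness
  let res : R₁ → k := fun y => Classical.choose (hrat (y : K) (hR₁O y.2))
  have res_spec : ∀ y : R₁, O.valuation ((y : K) - algebraMap k K (res y)) < 1 := fun y =>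
    Classical.choose_spec (hrat (y : K) (hR₁O y.2))
  have res_eq : ∀ (y : R₁) (c : k), O.valuation ((y : K) - algebraMap k K c) < 1 → res y = c :=
    fun y c h => residueConstant_unique O hk (res_spec y) h
  have hv1 : ∀ y : R₁, O.valuation (y : K) ≤ 1 := fun y =>
    (O.valuation_le_one_iff _).mpr (hR₁O y.2)
  have res_mul : ∀ y y' : R₁, res (y * y') = res y * res y' := by
    intro y y'
    apply res_eq
    have : ((y * y' : R₁) : K) - algebraMap k K (res y * res y') =
        (y : K) * ((y' : K) - algebraMap k K (res y')) +
          algebraMap k K (res y') * ((y : K) - algebraMap k K (res y)) := by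
      rw [map_mul]; push_cast; ring
    rw [this]
    refine Valuation.map_add_lt _ ?_ ?_
    · rw [map_mul]
      calc O.valuation (y : K) * O.valuation ((y' : K) - algebraMap k K (res y'))
          ≤ 1 * O.valuation ((y' : K) - algebraMap k K (res y')) := mul_le_mul' (hv1 y) le_rfl
        _ < 1 := by rw [one_mul]; exact res_spec y'
    · rw [map_mul]
      calc O.valuation (algebraMap k K (res y')) * O.valuation ((y : K) - algebraMap k K (res y))
          ≤ 1 * O.valuation ((y : K) - algebraMap k K (res y)) :=
            mul_le_mul' ((O.valuation_le_one_iff _).mpr (hk _)) le_rfl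
        _ < 1 := by rw [one_mul]; exact res_spec y
  have res_add : ∀ y y' : R₁, res (y + y') = res y + res y' := by
    intro y y'
    apply res_eq
    have : ((y + y' : R₁) : K) - algebraMap k K (res y + res y') =
        ((y : K) - algebraMap k K (res y)) + ((y' : K) - algebraMap k K (res y')) := by
      rw [map_add]; push_cast; ring
    rw [this]
    exact Valuation.map_add_lt _ (res_spec y) (res_spec y')
  have res_one : res 1 = 1 := res_eq 1 1 (by simp)
  have res_zero : res 0 = 0 := res_eq 0 0 (by simp)
  have res_algebraMap : ∀ c : k, res (algebraMap k R₁ c) = c := fun c =>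
    res_eq _ c (by simp)
  -- the `k`-algebra map `y ↦ res y ∈ k ⊆ K`
  let φ : R₁ →ₐ[k] K :=
    { toFun := fun y => algebraMap k K (res y)
      map_one' := by simp only [res_one, map_one]
      map_mul' := fun y y' => by simp only [res_mul, map_mul]
      map_zero' := by simp only [res_zero, map_zero]
      map_add' := fun y y' => by simp only [res_add, map_add]
      commutes' := fun c => by simp only [res_algebraMap] }
  have hφ : ∀ y : R₁, φ y = algebraMap k K (res y) := fun y => rfl
  have hlt_iff : ∀ y : R₁, O.valuation (φ y) < 1 ↔ res y = 0 := by
    intro y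
    rw [hφ]
    constructor
    · intro h
      by_contra hne
      rw [Summit.ResolutionOfSingularities.ResolutionOfSingularities.Theorems.PfaffLine.ap_valuation_algebraMap_eq_one O hk hne] at h
      exact lt_irrefl _ h
    · intro h
      rw [h, map_zero, map_zero]
      exact zero_lt_one
  have hcentre : ∀ y : R₁, O.valuation (φ y) < 1 ↔ O.valuation (y : K) < 1 := by
    intro y
    rw [hlt_iff]
    constructor
    · intro h
      have := res_spec y
      rwa [h, map_zero, sub_zero] at this
    · intro h
      exact res_eq y 0 (by rwa [map_zero, sub_zero])
  refine ⟨φ, fun y => ⟨res y, rfl⟩, fun y => res_spec y, fun y => hk _, hcentre, ?_, ?_⟩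
  · -- the semigroup is `{0, 1}`
    refine ⟨{0}, le_antisymm ?_ ?_⟩
    · refine Submonoid.closure_le.mpr ?_
      intro x hx
      rw [Finset.coe_singleton, Set.mem_singleton_iff] at hx
      exact ⟨0, by simp [hx]⟩
    · rintro x ⟨y, rfl⟩
      by_cases hy : res y = 0
      · have : (O.valuation.toMonoidWithZeroHom.toMonoidHom.comp φ.toRingHom.toMonoidHom) y =
            0 := by
          change O.valuation (φ y) = 0
          rw [hφ, hy, map_zero, map_zero]
        rw [this]
        exact Submonoid.subset_closure (by simp)
      · have : (O.valuation.toMonoidWithZeroHom.toMonoidHom.comp φ.toRingHom.toMonoidHom) y =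
            1 := by
          change O.valuation (φ y) = 1
          rw [hφ]
          exact Summit.ResolutionOfSingularities.ResolutionOfSingularities.Theorems.PfaffLine.ap_valuation_algebraMap_eq_one O hk hy
        rw [this]
        exact one_mem _
  · intro y hy
    refine ⟨1, ?_⟩
    have hne : res y ≠ 0 := by
      intro h
      apply hy
      rw [hφ, h, map_zero]
    rw [hφ, Summit.ResolutionOfSingularities.ResolutionOfSingularities.Theorems.PfaffLine.ap_valuation_algebraMap_eq_one O hk hne]
    simp

/-- **With [exact] deleted the shadow clause is free**: for EVERY rational valuation ring `O ∋ k`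
of a finitely generated `K/k` and every finitely generated `R ⊆ O`, the shadow clause minus its
last conjunct "`ι ∘ ν' ∘ φ = ν` on `F`" holds (residue-constant shadow on a birational
enlargement, `O' = O`, `ι = id`). [folklore] -/
theorem shadowClause_without_exact (hKfg : (⊤ : IntermediateField k K).FG)
    (O : ValuationSubring K) (hk : ∀ c : k, algebraMap k K c ∈ O)
    (hrat : ∀ x : K, x ∈ O → ∃ c : k, O.valuation (x - algebraMap k K c) < 1)
    (R : Subalgebra k K) (hR : R.FG) (hRO : R.toSubring ≤ O.toSubring) :
    ∃ (R₁ : Subalgebra k K) (_ : R ≤ R₁) (_ : R₁.toSubring ≤ O.toSubring),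
    R₁.FG ∧ IsFractionRing R₁ K ∧ ∃ (L : Type) (_ : Field L) (_ : Algebra k L) (φ : R₁ →ₐ[k] L)
    (O' : ValuationSubring L), Module.finrank ℤ (Additive (O'.ValueGroup)ˣ) =
      Module.finrank ℤ (Additive (O.ValueGroup)ˣ) ∧ (∀ y : R₁, φ y ∈ O') ∧
    (∀ y : R₁, O'.valuation (φ y) < 1 ↔ O.valuation (y : K) < 1) ∧
    (∀ z : L, z ∈ O' → ∃ c : k, O'.valuation (z - algebraMap k L c) < 1) ∧
    (MonoidHom.mrange (O'.valuation.toMonoidWithZeroHom.toMonoidHom.comp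
      φ.toRingHom.toMonoidHom)).FG ∧
    ∃ ι : O'.ValueGroup →*₀o O.ValueGroup, Function.Injective ι ∧
      (∀ y : R₁, φ y ≠ 0 → ∃ y' : R₁, ι (O'.valuation (φ y)) = O.valuation (y' : K)) := by
  obtain ⟨R₁, hle, hR₁O, hR₁, hfrac⟩ := exists_fg_isFractionRing_le hKfg O hk R hR hRO
  obtain ⟨φ, -, -, hin, hcentre, hfg, hval⟩ := residueConstantShadow O hk hrat R₁ hR₁O
  exact ⟨R₁, hle, hR₁O, hR₁, hfrac, K, inferInstance, inferInstance, φ, O, rfl, hin, hcentre, hrat,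
    hfg, OrderMonoidWithZeroHom.id _, fun _ _ h => h, hval⟩

/-- **[exact] is load-bearing: without it the crux IS the target.** The crux with the last shadow
clause "`ι (ν' (φ x)) = ν x` for `x ∈ F`" deleted is equivalent to `LurelRational` (its hypothesis
being free, `shadowClause_without_exact`). Together with `shadowsUniformize_without_fg_iff`: any
proof of the crux must use [fg] and [exact] jointly. [folklore] -/
theorem shadowsUniformize_without_exact_iff :
    (∀ p : ℕ, p.Prime → ∀ (k K : Type) [Field k] [CharP k p] [IsAlgClosed k] [Field K]
      [Algebra k K], (⊤ : IntermediateField k K).FG → ∀ O : ValuationSubring K,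
      (∀ c : k, algebraMap k K c ∈ O) →
      (∀ x : K, x ∈ O → ∃ c : k, O.valuation (x - algebraMap k K c) < 1) →
      ∀ R : Subalgebra k K, R.FG → R.toSubring ≤ O.toSubring →
      (∀ F : Finset R, ∃ (R₁ : Subalgebra k K) (_ : R ≤ R₁) (_ : R₁.toSubring ≤ O.toSubring),
        R₁.FG ∧ IsFractionRing R₁ K ∧ ∃ (L : Type) (_ : Field L) (_ : Algebra k L)
        (φ : R₁ →ₐ[k] L) (O' : ValuationSubring L),
        Module.finrank ℤ (Additive (O'.ValueGroup)ˣ) = Module.finrank ℤ (Additive (O.ValueGroup)ˣ) ∧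
        (∀ y : R₁, φ y ∈ O') ∧ (∀ y : R₁, O'.valuation (φ y) < 1 ↔ O.valuation (y : K) < 1) ∧
        (∀ z : L, z ∈ O' → ∃ c : k, O'.valuation (z - algebraMap k L c) < 1) ∧
        (MonoidHom.mrange (O'.valuation.toMonoidWithZeroHom.toMonoidHom.comp
          φ.toRingHom.toMonoidHom)).FG ∧
        ∃ ι : O'.ValueGroup →*₀o O.ValueGroup, Function.Injective ι ∧
          (∀ y : R₁, φ y ≠ 0 → ∃ y' : R₁, ι (O'.valuation (φ y)) = O.valuation (y' : K))) →
      ∃ (A : Subalgebra k K) (h : A.toSubring ≤ O.toSubring), R ≤ A ∧ A.FG ∧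
        IsFractionRing A K ∧ IsRegularLocalRing
          (Localization.AtPrime (Ideal.comap (Subring.inclusion h) (IsLocalRing.maximalIdeal O)))) ↔
    LurelRational :=
  ⟨fun h p hp k K _ _ _ _ _ hKfg O hk hrat R hR hRO =>
      h p hp k K hKfg O hk hrat R hR hRO fun _ => shadowClause_without_exact hKfg O hk hrat R hR hRO,
    fun h p hp k K _ _ _ _ _ hKfg O hk hrat R hR hRO _ => h p hp k K hKfg O hk hrat R hR hRO⟩

end LoadBearing

/-! ## §4 The c2 dense-Abhyankar carve-out: finitely generated value group (cycle 2; = `Negative/DenseAbhyankarValueGroup.lean`) -/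

section DenseAbhyankar

open Literature.AlgebraicGeometry.Resolution

variable {k K : Type} [Field k] [Field K] [Algebra k K]

/-- **Density makes every value of `K` a value of `K₀`.** If `K₀ ≤ K` is dense for `O`
(`IsDenseIn O K₀ ⊤`), every non-zero value of `O` on `K` is the value of a non-zero element of
`K₀`. [folklore] -/
theorem exists_mem_valuation_eq_of_isDenseIn (O : ValuationSubring K) (K₀ : Subfield K)
    (hdense : IsDenseIn O K₀ ⊤) (y : K) (hy0 : y ≠ 0) :
    ∃ z ∈ K₀, z ≠ 0 ∧ O.valuation z = O.valuation y := by
  obtain ⟨z, hz, hlt⟩ := hdense y (Subfield.mem_top y) y (Subfield.mem_top y) hy0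
  have hvz : O.valuation z = O.valuation y := by
    have h := Valuation.map_sub_eq_of_lt_left O.valuation hlt
    rwa [sub_sub_cancel] at h
  refine ⟨z, hz, fun h0 => hy0 ?_, hvz⟩
  rw [h0, map_zero] at hvz
  exact (map_eq_zero O.valuation).mp hvz.symm

/-- **A place in the completion of an Abhyankar subfunction field has a finitely generated value
group.** Let `k ⊆ O` and let `K₀` be an intermediate field of `K/k`, finitely generated over `k`,
on which `O` induces an ABHYANKAR place of `K₀/k` (`IsAbhyankarPlace`, Knaf–Kuhlmann 2005 §1),
and such that `K₀` is DENSE in `K` for `O` (`IsDenseIn O K₀ ⊤`). Then the value group of `O` is a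
finitely generated group: the value group of `(K₀, O ∩ K₀)` is finitely generated (Temkin 2013,
Remark 2.1.3 = tree `valueGroup_fg_of_transcendenceDefect_eq_zero`, the transcendence defect of an
Abhyankar place being `0`, tree `transcendenceDefect_comap_eq_zero_of_isAbhyankarPlace`), and by
density it is all of the value group of `K`. No rationality, characteristic or algebraic
closedness is used. [cite: KnafKuhlmann2005, Section 1 (inequality (1)) and Thm. 2.1] -/
theorem group_fg_valueGroup_of_isAbhyankarPlace_of_isDenseIn (O : ValuationSubring K)
    (hk : ∀ c : k, algebraMap k K c ∈ O) (K₀ : IntermediateField k K) (hK₀ : K₀.FG)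
    (hA : IsAbhyankarPlace O (algebraMap k K).fieldRange K₀.toSubfield)
    (hdense : IsDenseIn O K₀.toSubfield ⊤) :
    Group.FG (O.ValueGroup)ˣ := by
  classical
  obtain ⟨S, hS⟩ := hK₀
  set k' : Subfield K := (algebraMap k K).fieldRange with hk'def
  set M : IntermediateField k' K := IntermediateField.adjoin k' (S : Set K) with hM
  have hcl : K₀.toSubfield = Subfield.closure ((k' : Set K) ∪ (S : Set K)) := by
    rw [← hS, hk'def, RingHom.coe_fieldRange]
    rfl
  have hMF : ∀ z, z ∈ M ↔ z ∈ K₀.toSubfield := by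
    intro z
    rw [hM, mem_adjoin_subfield_iff, hcl]
  have hfgM : (⊤ : IntermediateField k' M).FG :=
    IntermediateField.fg_top_iff.mpr
      (IntermediateField.essFiniteType_iff.mpr (IntermediateField.fg_adjoin_finset S))
  have hKV : ((k' : Subfield K) : Set K) ⊆ O := by
    rintro _ ⟨c, rfl⟩
    exact hk c
  have hk'O : ∀ c : k', algebraMap k' M c ∈ O.comap (algebraMap M K) :=
    algebraMap_mem_comap_intermediateField O M hKV
  have hD : transcendenceDefect k' (O.comap (algebraMap M K)) hk'O = 0 :=
    transcendenceDefect_comap_eq_zero_of_isAbhyankarPlace O M hMF hKV hfgM hA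
  haveI : Group.FG ((O.comap (algebraMap M K)).ValueGroup)ˣ :=
    valueGroup_fg_of_transcendenceDefect_eq_zero _ hfgM hk'O hD
  have hsurj : Function.Surjective (unitsValueGroupHom M O) := by
    rw [← MonoidHom.range_eq_top, range_unitsValueGroupHom]
    refine eq_top_iff.mpr fun γ _ => ?_
    rw [mem_valueSubgroup_iff]
    obtain ⟨y, hy⟩ := O.valuation_surjective (γ : O.ValueGroup)
    have hy0 : y ≠ 0 := fun h => γ.ne_zero (by rw [← hy, h, map_zero])
    obtain ⟨z, hz, hz0, hvz⟩ := exists_mem_valuation_eq_of_isDenseIn O K₀.toSubfield hdense y hy0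
    refine ⟨⟨z, (hMF z).mpr hz⟩, fun h0 => hz0 (congrArg Subtype.val h0), ?_⟩
    rw [← hy, ← hvz]
    rfl
  exact Group.fg_of_surjective hsurj

/-- **Finitely generated value group of rational rank `≤ 1` is cyclic.** For a valuation ring
`O` whose value group is a finitely generated group with `Module.finrank ℤ ≤ 1` (the crux's
rendering of "rational rank `≤ 1`"), the value group is cyclic: a discrete place of rank `≤ 1`.
[folklore] -/
theorem isCyclic_valueGroup_of_group_fg_of_finrank_le_one (O : ValuationSubring K)
    [Group.FG (O.ValueGroup)ˣ] (h : Module.finrank ℤ (Additive (O.ValueGroup)ˣ) ≤ 1) :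
    IsCyclic (O.ValueGroup)ˣ := by
  haveI : Module.Finite ℤ (Additive (O.ValueGroup)ˣ) :=
    Module.Finite.iff_addGroup_fg.mpr inferInstance
  haveI : Module.Free ℤ (Additive (O.ValueGroup)ˣ) := Module.free_of_finite_type_torsion_free'
  obtain ⟨v, hv⟩ := finrank_le_one_iff.mp h
  rw [← isAddCyclic_additive_iff]
  refine ⟨⟨v, fun w => ?_⟩⟩
  obtain ⟨c, hc⟩ := hv w
  exact ⟨c, hc⟩

/-- **The dense-Abhyankar locus of rational rank `≤ 1` is the discrete locus.** If `k ⊆ O`, the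
value group of `O` has `Module.finrank ℤ ≤ 1`, and `O` lies in the completion of an Abhyankar
subfunction field `K₀` of `K/k` (`K₀` finitely generated over `k`, `O ∩ K₀` an Abhyankar place of
`K₀/k`, `K₀` dense in `K`), then the value group of `O` is CYCLIC.
[cite: KnafKuhlmann2005, Section 1 (inequality (1)) and Thm. 2.1] -/
theorem isCyclic_valueGroup_of_isAbhyankarPlace_of_isDenseIn (O : ValuationSubring K)
    (hk : ∀ c : k, algebraMap k K c ∈ O) (K₀ : IntermediateField k K) (hK₀ : K₀.FG)
    (hA : IsAbhyankarPlace O (algebraMap k K).fieldRange K₀.toSubfield)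
    (hdense : IsDenseIn O K₀.toSubfield ⊤)
    (hr : Module.finrank ℤ (Additive (O.ValueGroup)ˣ) ≤ 1) : IsCyclic (O.ValueGroup)ˣ := by
  haveI := group_fg_valueGroup_of_isAbhyankarPlace_of_isDenseIn O hk K₀ hK₀ hA hdense
  exact isCyclic_valueGroup_of_group_fg_of_finrank_le_one O hr

/-- **Line `birth` (lead c2), core stub: `hnD` is implied by `hndisc` in rational rank `≤ 1`.**
The c2 reshape added to `stub_shadowFrameTransfer_core` the hypothesis
`hnD : ¬ IsDenseAbhyankar O`, i.e. `¬ ∃ K₀, K₀.FG ∧ IsAbhyankarPlace O k K₀ ∧ IsDenseIn O K₀ ⊤`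
(written out here; the skeleton's `IsDenseAbhyankar` unfolds to it). For every `O ∋ k` whose value
group has `Module.finrank ℤ ≤ 1` and is NOT cyclic (the stub's `hndisc`), `hnD` holds
automatically: the dense-Abhyankar carve-out (Knaf–Kuhlmann 2009 Thm. 1.5) removes NOTHING from
the core locus in rational rank one. In particular every rational place of `K/k` with value group
a non-discrete subgroup of `ℚ` — all infinitely singular valuations of `k(x, y)` (where local
uniformization is classical but not in the tree) and the generic open case in `trdeg ≥ 4` — stays
in the core stub, whose content there is unchanged from cycle c1: relative local uniformization
given `HasShadows`. [cite: KnafKuhlmann2005, Section 1 (inequality (1)) and Thm. 2.1] -/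
theorem not_denseAbhyankar_of_not_isCyclic_of_finrank_le_one (O : ValuationSubring K)
    (hk : ∀ c : k, algebraMap k K c ∈ O) (hr : Module.finrank ℤ (Additive (O.ValueGroup)ˣ) ≤ 1)
    (hndisc : ¬ IsCyclic (O.ValueGroup)ˣ) :
    ¬ ∃ K₀ : IntermediateField k K, K₀.FG ∧
      IsAbhyankarPlace O (algebraMap k K).fieldRange K₀.toSubfield ∧ IsDenseIn O K₀.toSubfield ⊤ :=
  fun ⟨K₀, hK₀, hA, hdense⟩ =>
    hndisc (isCyclic_valueGroup_of_isAbhyankarPlace_of_isDenseIn O hk K₀ hK₀ hA hdense hr)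

/-- **The same, for value groups that are not finitely generated (any rational rank).** If the
value group of `O ∋ k` is not a finitely generated group — e.g. `ℤ[1/p]`, `ℤ + ℤ√2 + ⋯` with
unbounded denominators, any rank-one non-discrete subgroup of `ℚ` — then `O` is not in the
completion of any Abhyankar subfunction field: `hnD` of the core stub holds for free there too.
[cite: KnafKuhlmann2005, Section 1 (inequality (1)) and Thm. 2.1] -/
theorem not_denseAbhyankar_of_not_group_fg (O : ValuationSubring K)
    (hk : ∀ c : k, algebraMap k K c ∈ O) (hnfg : ¬ Group.FG (O.ValueGroup)ˣ) :
    ¬ ∃ K₀ : IntermediateField k K, K₀.FG ∧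
      IsAbhyankarPlace O (algebraMap k K).fieldRange K₀.toSubfield ∧ IsDenseIn O K₀.toSubfield ⊤ :=
  fun ⟨K₀, hK₀, hA, hdense⟩ =>
    hnfg (group_fg_valueGroup_of_isAbhyankarPlace_of_isDenseIn O hk K₀ hK₀ hA hdense)

end DenseAbhyankar

/-! ## §5 Line `birth` after the c2 reshape; junk shadows in rational rank one; the core locus of a surface (paper analysis, cycle 2)

-- Line birth (lead c2, skeleton `Lines/birth.lean` sha 0090bf33…):

JOINT SUFFICIENCY. `ShadowsUniformize_of (h₇ : Sig.stub_shadowFrameTransfer_core) : ShadowsUniformize`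
is a four-way `by_cases` (cyclic value group → `lurelDiscrete`, PROVED; Abhyankar place → tree
`relLU_at_abhyankarPlace_of_perfectField`; dense-Abhyankar → `lurelDenseAbhyankar` from the five c2
stubs + `stub_pullback`; else the core stub + the landed certifying half `regular_of_shadowFrame`).
It is kernel-checked modulo the registered stubs: the stubs as stated DO give the crux, nothing is
smuggled. The cut is honest but, on the typed hypothesis, cannot isolate less than LU on the core.

STUB VERDICTS (active stubs only).
* `stub_linDisjoint_of_dense_defectless` (KK09 Lemma 3.12 heart) — TRUE as typed. `IsDenseIn V F₀ K'`
  gives `vK' = vF₀` (take `c = y`) and `K'v = F₀v` (take `c = 1`). `L := F₀(d₁,…,dₙ)` is finite purely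
  inseparable over `F₀`, so `V ∩ L` is the unique prolongation of `V ∩ F₀` and `IsDefectlessField`
  (one-element `s` in `IsDefectlessIn`) reads `[L : F₀] = e·f`; coset representatives `aᵢ` of
  `vL/vF₀` and residue-basis lifts `bⱼ` give `e·f` products `aᵢbⱼ`, `F₀`-independent hence an
  `F₀`-basis of `L`, and `K'`-independent: in `Σ cᵢⱼ aᵢ bⱼ` (`cᵢⱼ ∈ K'`) the inner sums
  `Σⱼ cᵢⱼ bⱼ` have value `maxⱼ v(cᵢⱼ) ∈ vK' = vF₀` (residues of `cᵢⱼ/c` lie in `K'v = F₀v`, the `b̄ⱼ`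
  are `F₀v`-independent) and the outer terms then have values in distinct cosets of `vF₀`. A
  `K'`-independent `F₀`-basis of `L` makes `L`, `K'` linearly disjoint over `F₀`, which is symmetric:
  `Σ dᵢ sᵢ = 0`, `dᵢ ∈ L`, `sᵢ ∈ K'` `F₀`-independent ⇒ expand `dᵢ = Σ_β c_{iβ} β` ⇒ all `c_{iβ} = 0`.
  Degenerate cases: `n = 0` vacuous; `V ∩ F₀` trivial forces `K' ⊆ V` and then `K' = F₀` (density
  with `c = 1`), where independence is immediate. No junk found; not a target.
* `stub_denseAbhyankarAssembly` — TRUE (plumbing through `Ω = K̄`, as in `stub_discreteAssembly`).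
* `stub_shadowFrameTransfer_core` — = relative LU on the core locus, dressed as a frame. Its EXTRA
  conclusion `ToricShadowFrame O A h` follows on paper from regularity of `A_𝔭` (`dim d`, residue
  field `k`, `r = rr O ≤ d` finite): choose the r.s.p. `u₁,…,u_d` inside `A`, `Q := (u_{r+1},…,u_d)A_𝔭`
  (prime, complete intersection of height `d - r`), `ψ : A → A_𝔭/Q → L := Frac(A_𝔭/Q)`, `O'` the
  monomial valuation of the regular local ring `A_𝔭/Q` in `ū₁,…,ū_r` with `ℚ`-independent weights
  (rational, same centre, `ū` value-independent and generating the maximal ideal of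
  `D = (A/𝔮)_{𝔭} ≅ A_𝔭/Q`), `S := {u_{r+1},…,u_d}`. So crux ⇒ stub pointwise and the stub is
  irrefutable exactly like the crux (A). Its c2 hypothesis `hnD` is decoration in rational rank
  `≤ 1` (§4) and for every non-finitely-generated value group.

JUNK SHADOWS FROM EMBEDDED LU (finding (E), the argument). Let `r = rr O`, `F ⊆ R` finite; pick
`z₁,…,z_r ∈ R ∖ 0` with `ℚ`-independent values (values of `R ∖ 0` generate `Γ` since `Frac R = K`
may be assumed after the free enlargement `exists_fg_isFractionRing_le`). Suppose EMBEDDED LU holds for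
`(R, ν, F ∪ {zⱼ})`: a finitely generated `A`, `R ⊆ A ⊆ O`, `Frac A = K`, `A_𝔭` regular (`𝔭` the
centre, residue field `k`) with r.s.p. `u₁,…,u_d ∈ A`, every listed element `= ε·u^{a}` with
`ε ∈ A_𝔭ˣ`. Let `G := ⟨ν(u₁),…,ν(u_d)⟩ ≤ Γ`: finitely generated, torsion-free, of rank EXACTLY `r`
(it contains the values of the `zⱼ` up to the lattice they span; `≤ r` always). PERRON (Zariski;
Temkin 2013 Thm. A.2.1, PROVED in the tree as `Temkin2013_thmA_2_1`): `G` has a `ℤ`-basis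
`g₁,…,g_r > 0` with every `ν(uᵢ) = Σⱼ bᵢⱼ gⱼ`, `bᵢⱼ ∈ ℕ`. WEDGE: `R₁ := A`,
`φ : A ⊆ Â_𝔭 = k⟦u⟧ → k⟦s₁,…,s_r⟧ ⊂ L := k((s₁,…,s_r))`, `uᵢ ↦ s^{bᵢ} := ∏ⱼ sⱼ^{bᵢⱼ}` (a continuous
`k`-algebra map; `bᵢ ≠ 0` since `ν(uᵢ) > 0`); `O'` := the monomial valuation ring of `L` with
weights `(g₁,…,g_r)` (`ℚ`-independent reals once `Γ ⊗ ℚ ↪ ℝ` is fixed in rank one; in higher rank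
use the Hahn embedding — the order on `ℤ^r` is the one pulled back from `Γ` along `eⱼ ↦ gⱼ`);
`ι : eⱼ ↦ gⱼ`. Clauses: [rank] `r = r`; [inside] `φ(A) ⊆ k⟦s⟧ ⊆ O'`; [centre] `φ` is local;
[rational'] residue field `k`; [fg] the orders of `φ(A) ⊆ k⟦s^{b₁},…,s^{b_d}⟧` are the `w`-images
of the finitely generated monoid `M = Σᵢ ℕ bᵢ` (order of a series in the `s^{bᵢ}` = least `w`-value
of its support `⊆ M`), and all of them occur (`φ(u^c)`), so the semigroup is `w(M)`, generated by
the `ν(uᵢ)`; [inj] `gⱼ` a basis; [values] `ι(w(Σ cᵢbᵢ)) = Σ cᵢ ν(uᵢ) = ν(u^c)`, `u^c ∈ A`; [exact]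
`x = ε u^{a}` ⇒ `φ(x) = φ(ε) s^{Σ aᵢbᵢ}`, `φ(ε)` a unit, so `ι(ν'(φ x)) = Σ aᵢ ν(uᵢ) = ν(x)`. For
`r = 1` this is the scaled arc `uᵢ ↦ t^{ν(uᵢ)/h}`, `h` the positive generator of `G ≤ ℚ·γ` (refuter
ATTACK §4); `h` need not be a value of an element — only the ACTUAL orders `Σ cᵢ bᵢ` are
constrained by [values]. Hence `HasShadows O R` holds wherever embedded LU of finitely many
elements along `ν` is available — in particular at EVERY rational place of a surface (Zariski 1939:
LU, then embedded resolution of the curve `∏ x = 0` in the regular surface along `ν` by point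
blow-ups) and of a threefold (Cossart–Piltant 2008/2009 + embedded resolution of surfaces in
regular threefolds, Cossart–Piltant / Cutkosky 2009), and at every place where LU and
log-principalisation are known. For `R ⊆ k[x, y]` and `rr O = 1` there is also the INTENDED
shadow: the branch semivaluation of the `n`-th MacLane key polynomial `φₙ` of `ν` (for `n` with
`deg_y F < deg_y φₙ`): exact on `F` (MacLane: `ν = vₙ₋₁` below degree `deg φₙ`, and the infinite
augmentation `[vₙ₋₁; φₙ ↦ ∞]` agrees there), value group `Γₙ₋₁ ≤ Γ` (`ι` = inclusion),
plane-branch semigroup `⟨β̄₀,…,β̄ₙ₋₁⟩ = ⟨ν(x), ν(φ₁),…,ν(φₙ₋₁)⟩ ⊆ ν(R ∖ 0)`, same centre, residue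
field `k`, rational rank `1`. CALIBRATION (lead c1's request): confirmed on paper — `HasShadows`
holds at every rational surface valuation; a core `(O, R)` where it FAILS would have to live in
`trdeg ≥ 4` beyond known embedded LU and cannot be exhibited here. UPSHOT for the planner: the
typed hypothesis is "embedded-LU-lite" — monomial wedges of dimension `rr O` with exact `ν`-orders
on finite sets — and the typed crux reads "embedded-LU-lite ⇒ LU"; Teissier's transfer needs the
shadows to be the CANONICAL Abhyankar semivaluations on `R/K_α` with semigroups the initial
segments `⟨γ₁,…,γ_α⟩` of the minimal generating system of `ν(R ∖ 0)` (repair C′ on record).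

THE CORE LOCUS OF A SURFACE (finding (H)). `k(x, y) ↪ k((t^ℚ))`, `x ↦ t`, `y ↦ s := Σ_{i≥1} t^{eᵢ}`,
`eᵢ := 1 + Σ_{j≤i} 1/ℓⱼ` with distinct primes `ℓⱼ ≠ p`: the support of `s` has unbounded prime-to-`p`
denominators, so `s` is transcendental over `k((t))` (Kedlaya 2001: algebraic generalized power
series have support in some `(1/N)ℤ[1/p]`), the map is injective and `ν := ord_t` restricts to a
rational rank-one valuation of `k(x,y)` with residue field `k` and value group `⟨1, e₁, e₂, …⟩`
(revealed by the key polynomials `y`, `y^{ℓ₁} - x^{ℓ₁+1}`, …), NOT finitely generated. By §4 it is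
not dense-Abhyankar; it is not Abhyankar (`rr = 1 < 2`) and not discrete: a CORE place of `k(x,y)`
centred on `R = k[x, y]`, where `HasShadows` holds (curvettes) and the stub's conclusion is Zariski's
surface uniformization — true since 1939, absent from the tree. The core stub therefore also waits
on classical, un-formalised mathematics in `trdeg 2, 3`; only its `trdeg ≥ 4` part is the open
problem.
-/

end Summit.ResolutionOfSingularities.ResolutionOfSingularities.Cruxes.ShadowsUniformize.Disproof

end
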